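import Literature.NumberTheory.EllipticCurves.StevensSmoothingTransformProofs
import HarnessLib

/-!
# Un-smoothing a bounded set function: the Riemann sums of `ρ` converge as soon as those of
# `Sm_γ^γ ρ` do, and `(1 + T)·L(Sm_γ^γ ρ) = ((γ−1)²(1 + T) − γT²)·L(ρ)` (PROOFS ONLY)

Theorem-only sequel to `StevensSmoothingTransformProofs` (the transform of Stevens' two-sided smoothing
`Sm_r^r μ = μ − r[r]_*μ − r[r]^*μ + r²μ` of a bounded DISTRIBUTION) and `PAdicMeasureTransformTranslationProofs`
(translates `ν(z·)` of a bounded distribution). Here the distribution relation is DROPPED: for an arbitrary BOUNDED set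
function `ρ : (n : ℕ) → ZMod (pⁿ) → ℚ_p` (`‖ρ‖ ≤ C`) we prove

* `norm_riemannSum_translate_sub_le` — the finite-level estimate behind `tendsto_riemannSum_translate`, with no
  distribution hypothesis: `‖RS_z(k,n) − ∑_{i ≤ k} (−c choose k−i) RS(i,n)‖ ≤ C·p^{−n}/‖k!‖` (`z = η_z γ^{c}`);
* `norm_distributionRiemannSum_dilate_succ_sub_le` / `…_zero_sub_le` — for the push-forward `[γ]_*ρ` along the generator
  `γ = 1 + p^{e₀}` itself (`ℓ(γ) = 1`): `‖RS([γ]_*ρ)(k+1,n) − RS(ρ)(k+1,n) − RS(ρ)(k,n)‖ ≤ C·p^{−n}/‖(k+1)!‖`;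
* **`tendsto_distributionRiemannSum_of_stevensSmoothing`** (UN-SMOOTHING) — if the Riemann sums
  `RS(Sm_γ^γ ρ)(k,·)` converge for every `k`, then so do `RS(ρ)(k,·)` (and those of `[γ]^*ρ`, `[γ]_*ρ`), by induction
  on `k` from the recursion `(γ−1)²·RS(ρ)(k) = RS(Sm ρ)(k) + γ·RS(ρ)(k−1) − γ·RS([γ]^*ρ)(k−1) + o(1)`;
* **`one_add_X_mul_distributionTransform_stevensSmoothing`** — the transforms then satisfy
  `(1 + T)·L(Sm_γ^γ ρ) = ((γ−1)² + (γ−1)²T − γT²)·L(ρ)` in `ℚ_p⟦T⟧` (for `p = 2`, `γ = 5`: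
  `(1 + T)·L(Sm_5^5 ρ) = (16 + 16T − 5T²)·L(ρ)`, `one_add_X_mul_distributionTransform_stevensSmoothing_five`;
  cf. `one_add_X_mul_smoothingFactorTwo`). Since `16 + 16T − 5T² = unit · T²` modulo `2`, this is the source of the
  factor `T²` in mod-2 readings of `L(ρ)` from `L(Sm_5^5 ρ)`.

This is the converse direction of Stevens' smoothing (Stevens 1982 §5.4: `Sm` makes the Eisenstein boundary terms
integrable; here one recovers the transform of the un-smoothed object from the smoothed one by dividing by the smoothing
factor `1 + r² − r(1+T)^{ℓ(r)} − r(1+T)^{−ℓ(r)}`, done coefficientwise so that no distribution relation is needed) in the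
Riemann-sum language of Mazur–Tate–Teitelbaum §I.13. USE (cell bsd-rank2, line `star` of crux E1M, `stub_starEisNorm`):
the C-normalised Eisenstein cusp set function `eisNormMeasure` is bounded but is not a distribution; its smoothing splits
into bounded measures, so its Riemann sums converge and its transform is read off through this file.

References: G. Stevens, Arithmetic on Modular Curves, Progr. Math. 20 (1982), §5.2, §5.4 (PDF pp. 68–73) [Stevens1982];
B. Mazur, J. Tate, J. Teitelbaum, Invent. Math. 84 (1986), §I.13 (pp. 18–19) [MazurTateTeitelbaum1986Invent];
K. Matsuno, J. Number Theory 84 (2000), Lemma 3.3 (pp. 87–88) [Matsuno2000].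
-/

noncomputable section

open Filter Topology PowerSeries

namespace Literature.NumberTheory.EllipticCurves

variable {p : ℕ} [Fact p.Prime]

/-! ## 1. The translate estimate at finite level (no distribution relation) -/

/-- The exponent bookkeeping: `((s − c̄).val : ℤ_p) − (−c + s.val) ∈ pⁿℤ_p` (`c̄ = c mod pⁿ`). [folklore] -/
private theorem val_sub_sub_mem_span' (c : ℤ_[p]) (n : ℕ) (s : ZMod (p ^ n)) :
    ((s - PadicInt.toZModPow n c).val : ℤ_[p]) - (-c + (s.val : ℤ_[p])) ∈ Ideal.span {(p : ℤ_[p]) ^ n} := by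
  haveI : NeZero (p ^ n) := ⟨pow_ne_zero _ (Fact.out : p.Prime).ne_zero⟩
  rw [← PadicInt.ker_toZModPow, RingHom.mem_ker, map_sub, map_add, map_neg, map_natCast, map_natCast,
    ZMod.natCast_zmod_val, ZMod.natCast_zmod_val]
  ring

/-- **The translate estimate at finite level.** For ANY bounded set function `ν` on `ℤ_p` (`‖ν‖ ≤ C`, no distribution
relation), with Riemann sums `RS(k,n) = ∑_{η,s} ν(ηγˢ + p^{n+e₀})(s choose k)` and `RS_z(k,n)` those of the translate by
the classes `z_n = η_z γ^{c mod pⁿ}` (`c ∈ ℤ_p`):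
`‖RS_z(k,n) − ∑_{i ≤ k} (−c choose k−i)·RS(i,n)‖ ≤ C·p^{−n}/‖k!‖` — reindex along `u ↦ z·u`
(`finsum_sum_classes_translate`), Vandermonde (`sum_range_choose_mul_natChoose`) and the `p`-adic Lipschitz property of
`x ↦ (x choose k)` (`norm_choose_sub_choose_le_of_sub_mem_span`); this is the estimate inside
`tendsto_riemannSum_translate`, isolated. [cite: Matsuno2000, Lemma 3.3 (pp. 87–88), proof]
[cite: MazurTateTeitelbaum1986Invent, §I.13 (pp. 18–19)] -/
theorem norm_riemannSum_translate_sub_le {ν : (n : ℕ) → ZMod (p ^ n) → ℚ_[p]}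
    {C : ℝ} (hC : ∀ (n : ℕ) (a : ZMod (p ^ n)), ‖ν n a‖ ≤ C)
    {RS RSz : ℕ → ℕ → ℚ_[p]}
    (hRS : ∀ k n : ℕ, RS k n =
      ∑ᶠ η : rootsOfUnity (torsionOrder p) ℤ_[p], ∑ s : ZMod (p ^ n),
        ν (n + cyclotomicExponent p)
            (PadicInt.toZModPow (n + cyclotomicExponent p) ((η : ℤ_[p]ˣ) : ℤ_[p]) *
              (cyclotomicGenerator p : ZMod (p ^ (n + cyclotomicExponent p))) ^ s.val) *
          ((s.val.choose k : ℕ) : ℚ_[p]))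
    {ηz : rootsOfUnity (torsionOrder p) ℤ_[p]} {c : ℤ_[p]}
    (hRSz : ∀ k n : ℕ, RSz k n =
      ∑ᶠ η : rootsOfUnity (torsionOrder p) ℤ_[p], ∑ s : ZMod (p ^ n),
        ν (n + cyclotomicExponent p)
            ((PadicInt.toZModPow (n + cyclotomicExponent p) ((ηz : ℤ_[p]ˣ) : ℤ_[p]) *
              (cyclotomicGenerator p : ZMod (p ^ (n + cyclotomicExponent p))) ^ (PadicInt.toZModPow n c).val) *
            (PadicInt.toZModPow (n + cyclotomicExponent p) ((η : ℤ_[p]ˣ) : ℤ_[p]) *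
              (cyclotomicGenerator p : ZMod (p ^ (n + cyclotomicExponent p))) ^ s.val)) *
          ((s.val.choose k : ℕ) : ℚ_[p]))
    (k n : ℕ) :
    ‖RSz k n - ∑ i ∈ Finset.range (k + 1), algebraMap ℤ_[p] ℚ_[p] (Ring.choose (-c) (k - i)) * RS i n‖ ≤
      C * ((p : ℝ) ^ (-n : ℤ) / ‖((k.factorial : ℕ) : ℚ_[p])‖) := by
  classical
  haveI := neZero_torsionOrder p
  haveI := Fintype.ofFinite (rootsOfUnity (torsionOrder p) ℤ_[p])
  haveI : NeZero (p ^ n) := ⟨pow_ne_zero _ (Fact.out : p.Prime).ne_zero⟩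
  have hC0 : 0 ≤ C := (norm_nonneg _).trans (hC 0 0)
  -- `RSz k n = ∑_{η,s} ν(ηγˢ) ((s − c̄) choose k)` by the translation reindexing
  have hA : RSz k n = ∑ᶠ η : rootsOfUnity (torsionOrder p) ℤ_[p], ∑ s : ZMod (p ^ n),
      ν (n + cyclotomicExponent p)
          (PadicInt.toZModPow (n + cyclotomicExponent p) ((η : ℤ_[p]ˣ) : ℤ_[p]) *
            (cyclotomicGenerator p : ZMod (p ^ (n + cyclotomicExponent p))) ^ s.val) *
        (((s - PadicInt.toZModPow n c).val.choose k : ℕ) : ℚ_[p]) := by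
    rw [hRSz]
    exact finsum_sum_classes_translate (R := ℚ_[p]) n (ν (n + cyclotomicExponent p)) ηz (PadicInt.toZModPow n c)
      (fun s : ZMod (p ^ n) ↦ ((s.val.choose k : ℕ) : ℚ_[p]))
  -- `∑_i (−c choose k−i) RS(i,n) = ∑_{η,s} ν(ηγˢ) ((−c + s) choose k)` by Vandermonde
  have hB : ∑ i ∈ Finset.range (k + 1), algebraMap ℤ_[p] ℚ_[p] (Ring.choose (-c) (k - i)) * RS i n =
      ∑ᶠ η : rootsOfUnity (torsionOrder p) ℤ_[p], ∑ s : ZMod (p ^ n),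
      ν (n + cyclotomicExponent p)
          (PadicInt.toZModPow (n + cyclotomicExponent p) ((η : ℤ_[p]ˣ) : ℤ_[p]) *
            (cyclotomicGenerator p : ZMod (p ^ (n + cyclotomicExponent p))) ^ s.val) *
        algebraMap ℤ_[p] ℚ_[p] (Ring.choose (-c + (s.val : ℤ_[p])) k) := by
    simp only [hRS, finsum_eq_sum_of_fintype, Finset.mul_sum]
    rw [Finset.sum_comm]
    refine Finset.sum_congr rfl fun η _ ↦ ?_
    rw [Finset.sum_comm]
    refine Finset.sum_congr rfl fun s _ ↦ ?_
    rw [← sum_range_choose_mul_natChoose (-c) k s.val, Finset.mul_sum]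
    refine Finset.sum_congr rfl fun i _ ↦ ?_
    ring
  rw [hA, hB, finsum_eq_sum_of_fintype, finsum_eq_sum_of_fintype, ← Finset.sum_sub_distrib]
  refine IsUltrametricDist.norm_sum_le_of_forall_le_of_nonneg (by positivity) fun η _ ↦ ?_
  rw [← Finset.sum_sub_distrib]
  refine IsUltrametricDist.norm_sum_le_of_forall_le_of_nonneg (by positivity) fun s _ ↦ ?_
  rw [← mul_sub, norm_mul]
  refine mul_le_mul (hC _ _) ?_ (norm_nonneg _) hC0
  have hnat : (((s - PadicInt.toZModPow n c).val.choose k : ℕ) : ℚ_[p]) =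
      algebraMap ℤ_[p] ℚ_[p] (Ring.choose (((s - PadicInt.toZModPow n c).val : ℕ) : ℤ_[p]) k) := by
    rw [Ring.choose_natCast, map_natCast]
  rw [hnat]
  exact norm_choose_sub_choose_le_of_sub_mem_span k (val_sub_sub_mem_span' c n s)

/-- The error scale `C·p^{−n}/‖k!‖ → 0`. [folklore] -/
private theorem tendsto_errorScale (C : ℝ) (k : ℕ) :
    Tendsto (fun n : ℕ ↦ C * ((p : ℝ) ^ (-n : ℤ) / ‖((k.factorial : ℕ) : ℚ_[p])‖)) atTop (𝓝 0) := by
  have hp1 : (1 : ℝ) < p := by exact_mod_cast (Fact.out : p.Prime).one_lt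
  have h0 : Tendsto (fun n : ℕ ↦ (p : ℝ) ^ (-n : ℤ)) atTop (𝓝 0) := by
    have h := tendsto_pow_atTop_nhds_zero_of_lt_one (r := ((p : ℝ))⁻¹) (by positivity)
      (inv_lt_one_of_one_lt₀ hp1)
    refine h.congr fun n ↦ ?_
    rw [zpow_neg, zpow_natCast, inv_pow]
  simpa using (h0.div_const ‖((k.factorial : ℕ) : ℚ_[p])‖).const_mul C

/-- **Translates of a bounded set function with convergent Riemann sums** (the `hdist`-free form of
`tendsto_riemannSum_translate`): if `RS(i,·) → R i` for all `i ≤ k`, then `RS_z(k,·) → ∑_{i ≤ k} (−c choose k−i)·R i`.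
[cite: Matsuno2000, Lemma 3.3 (pp. 87–88), proof] [cite: MazurTateTeitelbaum1986Invent, §I.13 (pp. 18–19)] -/
theorem tendsto_riemannSum_translate_of_tendsto {ν : (n : ℕ) → ZMod (p ^ n) → ℚ_[p]}
    {C : ℝ} (hC : ∀ (n : ℕ) (a : ZMod (p ^ n)), ‖ν n a‖ ≤ C)
    {RS RSz : ℕ → ℕ → ℚ_[p]}
    (hRS : ∀ k n : ℕ, RS k n =
      ∑ᶠ η : rootsOfUnity (torsionOrder p) ℤ_[p], ∑ s : ZMod (p ^ n),
        ν (n + cyclotomicExponent p)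
            (PadicInt.toZModPow (n + cyclotomicExponent p) ((η : ℤ_[p]ˣ) : ℤ_[p]) *
              (cyclotomicGenerator p : ZMod (p ^ (n + cyclotomicExponent p))) ^ s.val) *
          ((s.val.choose k : ℕ) : ℚ_[p]))
    {ηz : rootsOfUnity (torsionOrder p) ℤ_[p]} {c : ℤ_[p]}
    (hRSz : ∀ k n : ℕ, RSz k n =
      ∑ᶠ η : rootsOfUnity (torsionOrder p) ℤ_[p], ∑ s : ZMod (p ^ n),
        ν (n + cyclotomicExponent p)
            ((PadicInt.toZModPow (n + cyclotomicExponent p) ((ηz : ℤ_[p]ˣ) : ℤ_[p]) *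
              (cyclotomicGenerator p : ZMod (p ^ (n + cyclotomicExponent p))) ^ (PadicInt.toZModPow n c).val) *
            (PadicInt.toZModPow (n + cyclotomicExponent p) ((η : ℤ_[p]ˣ) : ℤ_[p]) *
              (cyclotomicGenerator p : ZMod (p ^ (n + cyclotomicExponent p))) ^ s.val)) *
          ((s.val.choose k : ℕ) : ℚ_[p]))
    (k : ℕ) {R : ℕ → ℚ_[p]} (hconv : ∀ i ≤ k, Tendsto (fun n ↦ RS i n) atTop (𝓝 (R i))) :
    Tendsto (fun n ↦ RSz k n) atTop
      (𝓝 (∑ i ∈ Finset.range (k + 1), algebraMap ℤ_[p] ℚ_[p] (Ring.choose (-c) (k - i)) * R i)) := by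
  have hv : Tendsto (fun n ↦ ∑ i ∈ Finset.range (k + 1), algebraMap ℤ_[p] ℚ_[p] (Ring.choose (-c) (k - i)) * RS i n)
      atTop (𝓝 (∑ i ∈ Finset.range (k + 1), algebraMap ℤ_[p] ℚ_[p] (Ring.choose (-c) (k - i)) * R i)) :=
    tendsto_finsetSum _ fun i hi ↦ (hconv i (Nat.lt_succ_iff.mp (Finset.mem_range.mp hi))).const_mul _
  have hdiff : Tendsto (fun n ↦ RSz k n -
      ∑ i ∈ Finset.range (k + 1), algebraMap ℤ_[p] ℚ_[p] (Ring.choose (-c) (k - i)) * RS i n) atTop (𝓝 0) :=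
    squeeze_zero_norm (norm_riemannSum_translate_sub_le hC hRS hRSz k) (tendsto_errorScale C k)
  have := hdiff.add hv
  simpa using this

/-! ## 2. Push-forward along `γ` itself: `RS([γ]_*ρ)(k) ≈ RS(ρ)(k) + RS(ρ)(k−1)` -/

/-- `γ⁻¹ = γ^{(−1) mod pⁿ}` in `ℤ/p^{n+e₀}` (`γ` has order `pⁿ` there, `orderOf_cyclotomicGenerator`).
[cite: MazurTateTeitelbaum1986Invent, §I.13 (γ topological generator of 1 + p^{e₀}ℤ_p)] -/
theorem cyclotomicGenerator_inv_eq_pow (n : ℕ) :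
    ((cyclotomicGenerator p : ZMod (p ^ (n + cyclotomicExponent p))))⁻¹ =
      (cyclotomicGenerator p : ZMod (p ^ (n + cyclotomicExponent p))) ^
        (PadicInt.toZModPow n (-1 : ℤ_[p])).val := by
  haveI : NeZero (p ^ n) := ⟨pow_ne_zero _ (Fact.out : p.Prime).ne_zero⟩
  have hpow : (cyclotomicGenerator p : ZMod (p ^ (n + cyclotomicExponent p))) ^
      ((PadicInt.toZModPow n (-1 : ℤ_[p])).val + 1) = 1 := by
    rw [← orderOf_dvd_iff_pow_eq_one, orderOf_cyclotomicGenerator, ← ZMod.natCast_eq_zero_iff]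
    push_cast
    rw [ZMod.natCast_zmod_val, ← map_one (PadicInt.toZModPow n), ← map_add, neg_add_cancel, map_zero]
  refine ZMod.inv_eq_of_mul_eq_one _ _ _ ?_
  rw [← pow_succ', hpow]

/-- **The Riemann sums of `[γ]_*ρ` are those of the translate by `z = γ^{−1} = 1·γ^{(−1) mod pⁿ}`** (datum
`(η_z, c) = (1, −1)`), in the `hRSz` shape of `norm_riemannSum_translate_sub_le`.
[cite: MazurTateTeitelbaum1986Invent, §I.13 (pp. 18–19)] [cite: Stevens1982, §5.2 (PDF pp. 68–69)] -/
theorem distributionRiemannSum_dilate_cyclotomicGenerator (ρ : (n : ℕ) → ZMod (p ^ n) → ℚ_[p]) (k n : ℕ) :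
    distributionRiemannSum (dilate (cyclotomicGenerator p) ρ) k n =
      ∑ᶠ η : rootsOfUnity (torsionOrder p) ℤ_[p], ∑ s : ZMod (p ^ n),
        ρ (n + cyclotomicExponent p)
            ((PadicInt.toZModPow (n + cyclotomicExponent p)
                  (((1 : rootsOfUnity (torsionOrder p) ℤ_[p]) : ℤ_[p]ˣ) : ℤ_[p]) *
              (cyclotomicGenerator p : ZMod (p ^ (n + cyclotomicExponent p))) ^
                (PadicInt.toZModPow n (-1 : ℤ_[p])).val) *
            (PadicInt.toZModPow (n + cyclotomicExponent p) ((η : ℤ_[p]ˣ) : ℤ_[p]) *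
              (cyclotomicGenerator p : ZMod (p ^ (n + cyclotomicExponent p))) ^ s.val)) *
          ((s.val.choose k : ℕ) : ℚ_[p]) := by
  rw [distributionRiemannSum]
  refine finsum_congr fun η ↦ Finset.sum_congr rfl fun s _ ↦ ?_
  rw [dilate_apply, cyclotomicGenerator_inv_eq_pow, OneMemClass.coe_one, Units.val_one, map_one, one_mul]
  congr 2
  exact mul_comm _ _

/-- `∑_{i ≤ k+1} (1 choose k+1−i)·f i = f (k+1) + f k`. [folklore] -/
private theorem sum_range_choose_one_mul_succ (f : ℕ → ℚ_[p]) (k : ℕ) :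
    ∑ i ∈ Finset.range (k + 1 + 1), algebraMap ℤ_[p] ℚ_[p] (Ring.choose (-(-1 : ℤ_[p])) (k + 1 - i)) * f i =
      f (k + 1) + f k := by
  have hc : ∀ j, algebraMap ℤ_[p] ℚ_[p] (Ring.choose (-(-1 : ℤ_[p])) j) = ((Nat.choose 1 j : ℕ) : ℚ_[p]) := fun j ↦ by
    rw [neg_neg, ← Nat.cast_one, Ring.choose_natCast, map_natCast]
  simp_rw [hc]
  rw [Finset.sum_range_succ, Finset.sum_range_succ, Finset.sum_eq_zero fun i hi ↦ ?_]
  · rw [Nat.sub_self, Nat.choose_zero_right, show k + 1 - k = 1 by omega, Nat.choose_self]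
    push_cast
    ring
  · have hi' : i < k := Finset.mem_range.mp hi
    rw [Nat.choose_eq_zero_of_lt (by omega), Nat.cast_zero, zero_mul]

/-- `∑_{i ≤ 0} (1 choose 0−i)·f i = f 0`. [folklore] -/
private theorem sum_range_choose_one_mul_zero (f : ℕ → ℚ_[p]) :
    ∑ i ∈ Finset.range (0 + 1), algebraMap ℤ_[p] ℚ_[p] (Ring.choose (-(-1 : ℤ_[p])) (0 - i)) * f i = f 0 := by
  rw [zero_add, Finset.sum_range_one, Nat.sub_self, Ring.choose_zero_right, map_one, one_mul]

/-- **`‖RS([γ]_*ρ)(k+1,n) − (RS(ρ)(k+1,n) + RS(ρ)(k,n))‖ ≤ C·p^{−n}/‖(k+1)!‖`** for any bounded `ρ` (`‖ρ‖ ≤ C`): the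
push-forward along `γ` is the translate by `γ^{−1}`, `ℓ(γ^{−1}) = −1`, and `(1 choose j)` vanishes for `j ≥ 2`.
[cite: MazurTateTeitelbaum1986Invent, §I.13 (pp. 18–19)] [cite: Stevens1982, §5.4 (PDF p. 73)] -/
theorem norm_distributionRiemannSum_dilate_succ_sub_le {ρ : (n : ℕ) → ZMod (p ^ n) → ℚ_[p]} {C : ℝ}
    (hC : ∀ (n : ℕ) (a : ZMod (p ^ n)), ‖ρ n a‖ ≤ C) (k n : ℕ) :
    ‖distributionRiemannSum (dilate (cyclotomicGenerator p) ρ) (k + 1) n -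
        (distributionRiemannSum ρ (k + 1) n + distributionRiemannSum ρ k n)‖ ≤
      C * ((p : ℝ) ^ (-n : ℤ) / ‖(((k + 1).factorial : ℕ) : ℚ_[p])‖) := by
  have h := norm_riemannSum_translate_sub_le hC (distributionRiemannSum_spec ρ)
    (distributionRiemannSum_dilate_cyclotomicGenerator ρ) (k + 1) n
  rwa [sum_range_choose_one_mul_succ (fun i ↦ distributionRiemannSum ρ i n) k] at h

/-- The `k = 0` companion: `‖RS([γ]_*ρ)(0,n) − RS(ρ)(0,n)‖ ≤ C·p^{−n}`.
[cite: MazurTateTeitelbaum1986Invent, §I.13 (pp. 18–19)] [cite: Stevens1982, §5.4 (PDF p. 73)] -/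
theorem norm_distributionRiemannSum_dilate_zero_sub_le {ρ : (n : ℕ) → ZMod (p ^ n) → ℚ_[p]} {C : ℝ}
    (hC : ∀ (n : ℕ) (a : ZMod (p ^ n)), ‖ρ n a‖ ≤ C) (n : ℕ) :
    ‖distributionRiemannSum (dilate (cyclotomicGenerator p) ρ) 0 n - distributionRiemannSum ρ 0 n‖ ≤
      C * ((p : ℝ) ^ (-n : ℤ) / ‖((Nat.factorial 0 : ℕ) : ℚ_[p])‖) := by
  have h := norm_riemannSum_translate_sub_le hC (distributionRiemannSum_spec ρ)
    (distributionRiemannSum_dilate_cyclotomicGenerator ρ) 0 n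
  rwa [sum_range_choose_one_mul_zero (fun i ↦ distributionRiemannSum ρ i n)] at h

/-- `RS([γ]_*ρ)(k+1,·) − RS(ρ)(k+1,·) − RS(ρ)(k,·) → 0` for bounded `ρ`. [cite: MazurTateTeitelbaum1986Invent, §I.13 (pp. 18–19)] -/
theorem tendsto_distributionRiemannSum_dilate_succ_sub {ρ : (n : ℕ) → ZMod (p ^ n) → ℚ_[p]} {C : ℝ}
    (hC : ∀ (n : ℕ) (a : ZMod (p ^ n)), ‖ρ n a‖ ≤ C) (k : ℕ) :
    Tendsto (fun n ↦ distributionRiemannSum (dilate (cyclotomicGenerator p) ρ) (k + 1) n -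
        (distributionRiemannSum ρ (k + 1) n + distributionRiemannSum ρ k n)) atTop (𝓝 0) :=
  squeeze_zero_norm (norm_distributionRiemannSum_dilate_succ_sub_le hC k) (tendsto_errorScale C (k + 1))

/-- `RS([γ]_*ρ)(0,·) − RS(ρ)(0,·) → 0` for bounded `ρ`. [cite: MazurTateTeitelbaum1986Invent, §I.13 (pp. 18–19)] -/
theorem tendsto_distributionRiemannSum_dilate_zero_sub {ρ : (n : ℕ) → ZMod (p ^ n) → ℚ_[p]} {C : ℝ}
    (hC : ∀ (n : ℕ) (a : ZMod (p ^ n)), ‖ρ n a‖ ≤ C) :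
    Tendsto (fun n ↦ distributionRiemannSum (dilate (cyclotomicGenerator p) ρ) 0 n - distributionRiemannSum ρ 0 n)
      atTop (𝓝 0) :=
  squeeze_zero_norm (norm_distributionRiemannSum_dilate_zero_sub_le hC) (tendsto_errorScale C 0)

/-- The pull-back companion, `k + 1`: `RS(ρ)(k+1,·) − RS([γ]^*ρ)(k+1,·) − RS([γ]^*ρ)(k,·) → 0` (apply the push-forward
statement to `[γ]^*ρ`, `[γ]_*[γ]^* = 1`). [cite: MazurTateTeitelbaum1986Invent, §I.13 (pp. 18–19)] -/
theorem tendsto_distributionRiemannSum_sub_codilate_succ {ρ : (n : ℕ) → ZMod (p ^ n) → ℚ_[p]} {C : ℝ}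
    (hC : ∀ (n : ℕ) (a : ZMod (p ^ n)), ‖ρ n a‖ ≤ C) (k : ℕ) :
    Tendsto (fun n ↦ distributionRiemannSum ρ (k + 1) n -
        (distributionRiemannSum (codilate (cyclotomicGenerator p) ρ) (k + 1) n +
          distributionRiemannSum (codilate (cyclotomicGenerator p) ρ) k n)) atTop (𝓝 0) := by
  have hC' : ∀ (n : ℕ) (a : ZMod (p ^ n)), ‖codilate (cyclotomicGenerator p) ρ n a‖ ≤ C := fun n a ↦ hC _ _
  have h := tendsto_distributionRiemannSum_dilate_succ_sub hC' k
  rwa [dilate_codilate coprime_cyclotomicGenerator] at h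

/-- The pull-back companion, `k = 0`: `RS(ρ)(0,·) − RS([γ]^*ρ)(0,·) → 0`. [cite: MazurTateTeitelbaum1986Invent, §I.13 (pp. 18–19)] -/
theorem tendsto_distributionRiemannSum_sub_codilate_zero {ρ : (n : ℕ) → ZMod (p ^ n) → ℚ_[p]} {C : ℝ}
    (hC : ∀ (n : ℕ) (a : ZMod (p ^ n)), ‖ρ n a‖ ≤ C) :
    Tendsto (fun n ↦ distributionRiemannSum ρ 0 n - distributionRiemannSum (codilate (cyclotomicGenerator p) ρ) 0 n)
      atTop (𝓝 0) := by
  have hC' : ∀ (n : ℕ) (a : ZMod (p ^ n)), ‖codilate (cyclotomicGenerator p) ρ n a‖ ≤ C := fun n a ↦ hC _ _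
  have h := tendsto_distributionRiemannSum_dilate_zero_sub hC'
  rwa [dilate_codilate coprime_cyclotomicGenerator] at h

/-! ## 3. Un-smoothing -/

/-- `a − c − (a − (b + c)) = b`. [folklore] -/
private theorem sub_sub_sub_cancel_add {R : Type*} [CommRing R] (a b c : R) : a - c - (a - (b + c)) = b := by ring

/-- `γ − 1 = p^{e₀} ≠ 0` in `ℚ_p`. [cite: MazurTateTeitelbaum1986Invent, §I.13 (γ = 1 + p^{e₀})] -/
theorem cyclotomicGenerator_sub_one_ne_zero : ((cyclotomicGenerator p : ℕ) : ℚ_[p]) - 1 ≠ 0 := by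
  rw [cyclotomicGenerator]
  push_cast
  rw [add_sub_cancel_left]
  exact pow_ne_zero _ (by exact_mod_cast (Fact.out : p.Prime).ne_zero)

/-- **UN-SMOOTHING, convergence.** Let `ρ` be a bounded set function on `ℤ_p` (`‖ρ‖ ≤ C`; no distribution relation)
such that the Riemann sums of its smoothing `Sm_γ^γ ρ` along the generator `γ = 1 + p^{e₀}` converge: `RS(Sm_γ^γ ρ)(k,·)`
has a limit for every `k`. Then for every `k` the Riemann sums `RS(ρ)(k,·)` and `RS([γ]^*ρ)(k,·)` converge — induction on
`k` on the exact identity `RS(Sm ρ) = (1+γ²)RS(ρ) − γRS([γ]_*ρ) − γRS([γ]^*ρ)` (`distributionRiemannSum_stevensSmoothing`)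
and the estimates of §2: `(γ−1)²·RS(ρ)(k) = RS(Sm ρ)(k) + γRS(ρ)(k−1) − γRS([γ]^*ρ)(k−1) + o(1)`.
[cite: Stevens1982, §5.4 (PDF pp. 72–73)] [cite: MazurTateTeitelbaum1986Invent, §I.13 (pp. 18–19)] -/
theorem exists_tendsto_distributionRiemannSum_of_stevensSmoothing {ρ : (n : ℕ) → ZMod (p ^ n) → ℚ_[p]} {C : ℝ}
    (hC : ∀ (n : ℕ) (a : ZMod (p ^ n)), ‖ρ n a‖ ≤ C)
    (hS : ∀ k, ∃ S : ℚ_[p],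
      Tendsto (distributionRiemannSum (stevensSmoothing (cyclotomicGenerator p) ρ) k) atTop (𝓝 S)) (k : ℕ) :
    (∃ H : ℚ_[p], Tendsto (distributionRiemannSum ρ k) atTop (𝓝 H)) ∧
      ∃ G : ℚ_[p], Tendsto (distributionRiemannSum (codilate (cyclotomicGenerator p) ρ) k) atTop (𝓝 G) := by
  have hγ := cyclotomicGenerator_sub_one_ne_zero (p := p)
  have hγ2 : (((cyclotomicGenerator p : ℕ) : ℚ_[p]) - 1) ^ 2 ≠ 0 := pow_ne_zero 2 hγ
  have hSm := distributionRiemannSum_stevensSmoothing (μ := ρ) (cyclotomicGenerator p)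
  induction k with
  | zero =>
    obtain ⟨S, hS0⟩ := hS 0
    have e1 := tendsto_distributionRiemannSum_dilate_zero_sub hC
    have e3 := tendsto_distributionRiemannSum_sub_codilate_zero hC
    -- `(γ−1)²·RS(ρ)(0) = RS(Sm ρ)(0) + γ·e1 − γ·e3`
    have key : ∀ n, distributionRiemannSum ρ 0 n = ((((cyclotomicGenerator p : ℕ) : ℚ_[p]) - 1) ^ 2)⁻¹ *
        (distributionRiemannSum (stevensSmoothing (cyclotomicGenerator p) ρ) 0 n +
          (cyclotomicGenerator p : ℚ_[p]) *
            (distributionRiemannSum (dilate (cyclotomicGenerator p) ρ) 0 n - distributionRiemannSum ρ 0 n) -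
          (cyclotomicGenerator p : ℚ_[p]) *
            (distributionRiemannSum ρ 0 n - distributionRiemannSum (codilate (cyclotomicGenerator p) ρ) 0 n)) := by
      intro n
      rw [eq_inv_mul_iff_mul_eq₀ hγ2, hSm]
      ring
    have hH : Tendsto (distributionRiemannSum ρ 0) atTop
        (𝓝 (((((cyclotomicGenerator p : ℕ) : ℚ_[p]) - 1) ^ 2)⁻¹ *
          (S + (cyclotomicGenerator p : ℚ_[p]) * 0 - (cyclotomicGenerator p : ℚ_[p]) * 0))) := by
      have := ((hS0.add (e1.const_mul (cyclotomicGenerator p : ℚ_[p]))).sub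
        (e3.const_mul (cyclotomicGenerator p : ℚ_[p]))).const_mul
        ((((cyclotomicGenerator p : ℕ) : ℚ_[p]) - 1) ^ 2)⁻¹
      exact this.congr fun n ↦ (key n).symm
    -- `RS([γ]^*ρ)(0) = RS(ρ)(0) − e3`
    obtain ⟨H₀, hH₀⟩ : ∃ H : ℚ_[p], Tendsto (distributionRiemannSum ρ 0) atTop (𝓝 H) := ⟨_, hH⟩
    exact ⟨⟨H₀, hH₀⟩, H₀ - 0, (hH₀.sub e3).congr fun n ↦ sub_sub_cancel _ _⟩
  | succ k ih =>
    obtain ⟨⟨H, hH⟩, G, hG⟩ := ih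
    obtain ⟨S, hS1⟩ := hS (k + 1)
    have e1 := tendsto_distributionRiemannSum_dilate_succ_sub hC k
    have e3 := tendsto_distributionRiemannSum_sub_codilate_succ hC k
    -- `(γ−1)²·RS(ρ)(k+1) = RS(Sm ρ)(k+1) + γRS(ρ)(k) + γ·e1 − γRS([γ]^*ρ)(k) − γ·e3`
    have key : ∀ n, distributionRiemannSum ρ (k + 1) n = ((((cyclotomicGenerator p : ℕ) : ℚ_[p]) - 1) ^ 2)⁻¹ *
        (distributionRiemannSum (stevensSmoothing (cyclotomicGenerator p) ρ) (k + 1) n +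
          (cyclotomicGenerator p : ℚ_[p]) * distributionRiemannSum ρ k n +
          (cyclotomicGenerator p : ℚ_[p]) *
            (distributionRiemannSum (dilate (cyclotomicGenerator p) ρ) (k + 1) n -
              (distributionRiemannSum ρ (k + 1) n + distributionRiemannSum ρ k n)) -
          (cyclotomicGenerator p : ℚ_[p]) * distributionRiemannSum (codilate (cyclotomicGenerator p) ρ) k n -
          (cyclotomicGenerator p : ℚ_[p]) *
            (distributionRiemannSum ρ (k + 1) n -
              (distributionRiemannSum (codilate (cyclotomicGenerator p) ρ) (k + 1) n +
                distributionRiemannSum (codilate (cyclotomicGenerator p) ρ) k n))) := by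
      intro n
      rw [eq_inv_mul_iff_mul_eq₀ hγ2, hSm]
      ring
    have hH' : Tendsto (distributionRiemannSum ρ (k + 1)) atTop
        (𝓝 (((((cyclotomicGenerator p : ℕ) : ℚ_[p]) - 1) ^ 2)⁻¹ *
          (S + (cyclotomicGenerator p : ℚ_[p]) * H + (cyclotomicGenerator p : ℚ_[p]) * 0 -
            (cyclotomicGenerator p : ℚ_[p]) * G - (cyclotomicGenerator p : ℚ_[p]) * 0))) := by
      have := ((((hS1.add (hH.const_mul (cyclotomicGenerator p : ℚ_[p]))).add
        (e1.const_mul (cyclotomicGenerator p : ℚ_[p]))).sub (hG.const_mul (cyclotomicGenerator p : ℚ_[p]))).sub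
        (e3.const_mul (cyclotomicGenerator p : ℚ_[p]))).const_mul
        ((((cyclotomicGenerator p : ℕ) : ℚ_[p]) - 1) ^ 2)⁻¹
      exact this.congr fun n ↦ (key n).symm
    -- `RS([γ]^*ρ)(k+1) = RS(ρ)(k+1) − RS([γ]^*ρ)(k) − e3`
    obtain ⟨H₁, hH₁⟩ : ∃ H : ℚ_[p], Tendsto (distributionRiemannSum ρ (k + 1)) atTop (𝓝 H) := ⟨_, hH'⟩
    exact ⟨⟨H₁, hH₁⟩, H₁ - G - 0, ((hH₁.sub hG).sub e3).congr fun n ↦ sub_sub_sub_cancel_add _ _ _⟩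

/-- **UN-SMOOTHING: the Riemann sums of `ρ` converge to the coefficients of its transform** `L(ρ)` (which is DEFINED as
the coefficientwise `limUnder`), under the hypotheses of `exists_tendsto_distributionRiemannSum_of_stevensSmoothing`.
[cite: Stevens1982, §5.4 (PDF pp. 72–73)] [cite: MazurTateTeitelbaum1986Invent, §I.13 (pp. 18–19)] -/
theorem tendsto_distributionRiemannSum_of_stevensSmoothing {ρ : (n : ℕ) → ZMod (p ^ n) → ℚ_[p]} {C : ℝ}
    (hC : ∀ (n : ℕ) (a : ZMod (p ^ n)), ‖ρ n a‖ ≤ C)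
    (hS : ∀ k, ∃ S : ℚ_[p],
      Tendsto (distributionRiemannSum (stevensSmoothing (cyclotomicGenerator p) ρ) k) atTop (𝓝 S)) (k : ℕ) :
    Tendsto (distributionRiemannSum ρ k) atTop (𝓝 (PowerSeries.coeff k (distributionTransform ρ))) := by
  rw [coeff_distributionTransform]
  exact tendsto_nhds_limUnder (exists_tendsto_distributionRiemannSum_of_stevensSmoothing hC hS k).1

/-- Under the same hypotheses the Riemann sums of the pull-back `[γ]^*ρ` converge to the coefficients of `L([γ]^*ρ)`.
[cite: Stevens1982, §5.4 (PDF pp. 72–73)] [cite: MazurTateTeitelbaum1986Invent, §I.13 (pp. 18–19)] -/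
theorem tendsto_distributionRiemannSum_codilate_of_stevensSmoothing {ρ : (n : ℕ) → ZMod (p ^ n) → ℚ_[p]} {C : ℝ}
    (hC : ∀ (n : ℕ) (a : ZMod (p ^ n)), ‖ρ n a‖ ≤ C)
    (hS : ∀ k, ∃ S : ℚ_[p],
      Tendsto (distributionRiemannSum (stevensSmoothing (cyclotomicGenerator p) ρ) k) atTop (𝓝 S)) (k : ℕ) :
    Tendsto (distributionRiemannSum (codilate (cyclotomicGenerator p) ρ) k) atTop
      (𝓝 (PowerSeries.coeff k (distributionTransform (codilate (cyclotomicGenerator p) ρ)))) := by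
  rw [coeff_distributionTransform]
  exact tendsto_nhds_limUnder (exists_tendsto_distributionRiemannSum_of_stevensSmoothing hC hS k).2

/-- `[T^{k+1}]((1 + T)·φ) = [T^{k+1}]φ + [T^k]φ`. [folklore] -/
private theorem coeff_succ_one_add_X_mul {R : Type*} [CommRing R] (φ : PowerSeries R) (k : ℕ) :
    PowerSeries.coeff (k + 1) ((1 + X) * φ) = PowerSeries.coeff (k + 1) φ + PowerSeries.coeff k φ := by
  rw [add_mul, one_mul, map_add, coeff_succ_X_mul]

/-- `[T^0]((1 + T)·φ) = [T^0]φ`. [folklore] -/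
private theorem coeff_zero_one_add_X_mul {R : Type*} [CommRing R] (φ : PowerSeries R) :
    PowerSeries.coeff 0 ((1 + X) * φ) = PowerSeries.coeff 0 φ := by
  rw [add_mul, one_mul, map_add, coeff_zero_X_mul, add_zero]

/-- **UN-SMOOTHING: `L(ρ) = (1 + T)·L([γ]^*ρ)` and `L([γ]_*ρ) = (1 + T)·L(ρ)`** for a bounded `ρ` whose smoothing has
convergent Riemann sums (the translate formula `L[ν(z·)] = (1+T)^{−ℓ(z)}L[ν]` at `z = γ^{±1}`, now without the distribution
relation). [cite: Stevens1982, §5.4 (PDF pp. 72–73)] [cite: MazurTateTeitelbaum1986Invent, §I.13 (pp. 18–19)] -/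
theorem distributionTransform_eq_one_add_X_mul_codilate_of_stevensSmoothing {ρ : (n : ℕ) → ZMod (p ^ n) → ℚ_[p]}
    {C : ℝ} (hC : ∀ (n : ℕ) (a : ZMod (p ^ n)), ‖ρ n a‖ ≤ C)
    (hS : ∀ k, ∃ S : ℚ_[p],
      Tendsto (distributionRiemannSum (stevensSmoothing (cyclotomicGenerator p) ρ) k) atTop (𝓝 S)) :
    distributionTransform ρ = (1 + X) * distributionTransform (codilate (cyclotomicGenerator p) ρ) ∧
      distributionTransform (dilate (cyclotomicGenerator p) ρ) = (1 + X) * distributionTransform ρ := by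
  have hH := tendsto_distributionRiemannSum_of_stevensSmoothing hC hS
  have hG := tendsto_distributionRiemannSum_codilate_of_stevensSmoothing hC hS
  constructor
  · ext k
    rcases k with _ | k
    · rw [coeff_zero_one_add_X_mul, ← sub_eq_zero]
      exact tendsto_nhds_unique ((hH 0).sub (hG 0)) (tendsto_distributionRiemannSum_sub_codilate_zero hC)
    · rw [coeff_succ_one_add_X_mul, ← sub_eq_zero]
      exact tendsto_nhds_unique ((hH (k + 1)).sub ((hG (k + 1)).add (hG k)))
        (tendsto_distributionRiemannSum_sub_codilate_succ hC k)
  · ext k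
    rw [coeff_distributionTransform]
    rcases k with _ | k
    · rw [coeff_zero_one_add_X_mul]
      refine Tendsto.limUnder_eq ?_
      have := (tendsto_distributionRiemannSum_dilate_zero_sub hC).add (hH 0)
      simpa using this
    · rw [coeff_succ_one_add_X_mul]
      refine Tendsto.limUnder_eq ?_
      have := (tendsto_distributionRiemannSum_dilate_succ_sub hC k).add ((hH (k + 1)).add (hH k))
      simpa using this

/-- **UN-SMOOTHING: the transform identity `(1 + T)·L(Sm_γ^γ ρ) = ((γ−1)² + (γ−1)²T − γT²)·L(ρ)`** in `ℚ_p⟦T⟧`, for a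
bounded set function `ρ` on `ℤ_p` (no distribution relation) whose smoothing `Sm_γ^γ ρ` has convergent Riemann sums:
`L(Sm ρ) = (1+γ²)L(ρ) − γL([γ]_*ρ) − γL([γ]^*ρ)` coefficientwise, `L([γ]_*ρ) = (1+T)L(ρ)`, `L(ρ) = (1+T)L([γ]^*ρ)`, and
`(1+T)(1+γ²) − γ(1+T)² − γ = (γ−1)²(1+T) − γT²` — the smoothing factor `1 + γ² − γ(1+T) − γ(1+T)^{−1}` of
`distributionTransform_stevensSmoothing_of_datum` cleared of its denominator `1 + T`.
[cite: Stevens1982, §5.4 (PDF pp. 72–73)] [cite: MazurTateTeitelbaum1986Invent, §I.13 (pp. 18–19)] -/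
theorem one_add_X_mul_distributionTransform_stevensSmoothing {ρ : (n : ℕ) → ZMod (p ^ n) → ℚ_[p]} {C : ℝ}
    (hC : ∀ (n : ℕ) (a : ZMod (p ^ n)), ‖ρ n a‖ ≤ C)
    (hS : ∀ k, ∃ S : ℚ_[p],
      Tendsto (distributionRiemannSum (stevensSmoothing (cyclotomicGenerator p) ρ) k) atTop (𝓝 S)) :
    (1 + X) * distributionTransform (stevensSmoothing (cyclotomicGenerator p) ρ) =
      (PowerSeries.C ((((cyclotomicGenerator p : ℕ) : ℚ_[p]) - 1) ^ 2) +
          PowerSeries.C ((((cyclotomicGenerator p : ℕ) : ℚ_[p]) - 1) ^ 2) * X -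
          PowerSeries.C ((cyclotomicGenerator p : ℕ) : ℚ_[p]) * X ^ 2) * distributionTransform ρ := by
  have hH := tendsto_distributionRiemannSum_of_stevensSmoothing hC hS
  have hG := tendsto_distributionRiemannSum_codilate_of_stevensSmoothing hC hS
  obtain ⟨hcod, hdil⟩ := distributionTransform_eq_one_add_X_mul_codilate_of_stevensSmoothing hC hS
  -- the Riemann sums of the push-forward converge to the coefficients of its transform
  have hD : ∀ k, Tendsto (distributionRiemannSum (dilate (cyclotomicGenerator p) ρ) k) atTop
      (𝓝 (PowerSeries.coeff k (distributionTransform (dilate (cyclotomicGenerator p) ρ)))) := by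
    intro k
    rw [hdil]
    rcases k with _ | k
    · rw [coeff_zero_one_add_X_mul]
      have := (tendsto_distributionRiemannSum_dilate_zero_sub hC).add (hH 0)
      simpa using this
    · rw [coeff_succ_one_add_X_mul]
      have := (tendsto_distributionRiemannSum_dilate_succ_sub hC k).add ((hH (k + 1)).add (hH k))
      simpa using this
  -- `L(Sm ρ) = (1+γ²)L(ρ) − γL([γ]_*ρ) − γL([γ]^*ρ)` coefficientwise
  have hSm : distributionTransform (stevensSmoothing (cyclotomicGenerator p) ρ) =
      distributionTransform ρ - PowerSeries.C ((cyclotomicGenerator p : ℕ) : ℚ_[p]) *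
          distributionTransform (dilate (cyclotomicGenerator p) ρ) -
        PowerSeries.C ((cyclotomicGenerator p : ℕ) : ℚ_[p]) *
          distributionTransform (codilate (cyclotomicGenerator p) ρ) +
        PowerSeries.C (((cyclotomicGenerator p : ℕ) : ℚ_[p]) ^ 2) * distributionTransform ρ := by
    ext k
    rw [coeff_distributionTransform]
    refine Tendsto.limUnder_eq ?_
    simp only [map_add, map_sub, PowerSeries.coeff_C_mul]
    have := (((hH k).sub ((hD k).const_mul ((cyclotomicGenerator p : ℕ) : ℚ_[p]))).sub
      ((hG k).const_mul ((cyclotomicGenerator p : ℕ) : ℚ_[p]))).add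
      ((hH k).const_mul (((cyclotomicGenerator p : ℕ) : ℚ_[p]) ^ 2))
    exact this.congr fun n ↦ (distributionRiemannSum_stevensSmoothing (μ := ρ) (cyclotomicGenerator p) k n).symm
  -- assemble
  set L := distributionTransform (codilate (cyclotomicGenerator p) ρ)
  rw [hSm, hdil, hcod]
  simp only [map_pow, map_sub, map_one]
  ring

/-! ## 4. The prime `2`: `(1 + T)·L(Sm_5^5 ρ) = (16 + 16T − 5T²)·L(ρ)` -/

/-- `γ = 5` for `p = 2`. [cite: MazurTateTeitelbaum1986Invent, §I.13 (γ = 5 at p = 2)] -/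
private theorem cyclotomicGenerator_two'' : cyclotomicGenerator 2 = 5 := by
  simp [cyclotomicGenerator, cyclotomicExponent]

/-- **`p = 2`: the Riemann sums of a bounded `ρ` converge once those of `Sm_5^5 ρ` do.**
[cite: Stevens1982, §5.4 (PDF pp. 72–73)] [cite: MazurTateTeitelbaum1986Invent, §I.13 (pp. 18–19)] -/
theorem tendsto_distributionRiemannSum_of_stevensSmoothing_five {ρ : (n : ℕ) → ZMod (2 ^ n) → ℚ_[2]} {C : ℝ}
    (hC : ∀ (n : ℕ) (a : ZMod (2 ^ n)), ‖ρ n a‖ ≤ C)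
    (hS : ∀ k, ∃ S : ℚ_[2], Tendsto (distributionRiemannSum (stevensSmoothing 5 ρ) k) atTop (𝓝 S)) (k : ℕ) :
    Tendsto (distributionRiemannSum ρ k) atTop (𝓝 (PowerSeries.coeff k (distributionTransform ρ))) := by
  have hS' : ∀ k, ∃ S : ℚ_[2],
      Tendsto (distributionRiemannSum (stevensSmoothing (cyclotomicGenerator 2) ρ) k) atTop (𝓝 S) := by
    rw [cyclotomicGenerator_two'']; exact hS
  exact tendsto_distributionRiemannSum_of_stevensSmoothing hC hS' k

/-- **`p = 2`: `(1 + T)·L(Sm_5^5 ρ) = (16 + 16T − 5T²)·L(ρ)`** for a bounded set function `ρ` on `ℤ₂` whose smoothing has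
convergent Riemann sums (cf. `one_add_X_mul_smoothingFactorTwo`: `(1+T)(26 − 5(1+T) − 5(1+T)^{−1}) = 16 + 16T − 5T²`).
Modulo `2` the right factor is `T²`: this is the `T²` in mod-2 readings of `L(ρ)` through `L(Sm_5^5 ρ)`.
[cite: Stevens1982, §5.4 (PDF pp. 72–73)] [cite: MazurTateTeitelbaum1986Invent, §I.13 (pp. 18–19)] -/
theorem one_add_X_mul_distributionTransform_stevensSmoothing_five {ρ : (n : ℕ) → ZMod (2 ^ n) → ℚ_[2]} {C : ℝ}
    (hC : ∀ (n : ℕ) (a : ZMod (2 ^ n)), ‖ρ n a‖ ≤ C)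
    (hS : ∀ k, ∃ S : ℚ_[2], Tendsto (distributionRiemannSum (stevensSmoothing 5 ρ) k) atTop (𝓝 S)) :
    (1 + X) * distributionTransform (stevensSmoothing 5 ρ) =
      (PowerSeries.C (16 : ℚ_[2]) + PowerSeries.C (16 : ℚ_[2]) * X - PowerSeries.C (5 : ℚ_[2]) * X ^ 2) *
        distributionTransform ρ := by
  have hS' : ∀ k, ∃ S : ℚ_[2],
      Tendsto (distributionRiemannSum (stevensSmoothing (cyclotomicGenerator 2) ρ) k) atTop (𝓝 S) := by
    rw [cyclotomicGenerator_two'']; exact hS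
  have h := one_add_X_mul_distributionTransform_stevensSmoothing hC hS'
  rw [cyclotomicGenerator_two''] at h
  rw [h]
  norm_num

/-! ## 5. Set functions with the distribution relation from some level on -/

/-- **The Riemann sums of a bounded set function satisfying the distribution relation from level `n₀` on converge** (to
the coefficients of its transform): replacing the levels below `n₀` by the push-forward of level `n₀` changes no Riemann
sum `RS(k,n)` with `n + e₀ ≥ n₀` and produces a bounded distribution, to which `tendsto_riemannSum_of_distribution` applies.
[cite: MazurTateTeitelbaum1986Invent, §I.11 (11.1), §I.13 (pp. 18–19)] -/
theorem tendsto_distributionRiemannSum_of_eventually_distribution {μ : (n : ℕ) → ZMod (p ^ n) → ℚ_[p]} (n₀ : ℕ)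
    (hdist : ∀ n, n₀ ≤ n → ∀ a : ZMod (p ^ n),
      ∑ b ∈ Finset.univ.filter (fun b : ZMod (p ^ (n + 1)) ↦
        ZMod.castHom (pow_dvd_pow p n.le_succ) (ZMod (p ^ n)) b = a), μ (n + 1) b = μ n a)
    {C : ℝ} (hC : ∀ (n : ℕ) (a : ZMod (p ^ n)), ‖μ n a‖ ≤ C) (k : ℕ) :
    Tendsto (distributionRiemannSum μ k) atTop (𝓝 (PowerSeries.coeff k (distributionTransform μ))) := by
  classical
  have hC0 : 0 ≤ C := (norm_nonneg _).trans (hC 0 0)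
  -- the modified set function: push level `n₀` forward to the levels below it
  let μ' : (n : ℕ) → ZMod (p ^ n) → ℚ_[p] := fun n a ↦
    if h : n₀ ≤ n then μ n a else
      ∑ b ∈ Finset.univ.filter (fun b : ZMod (p ^ n₀) ↦
        ZMod.castHom (pow_dvd_pow p (le_of_not_ge h)) (ZMod (p ^ n)) b = a), μ n₀ b
  have hge : ∀ n, n₀ ≤ n → ∀ a, μ' n a = μ n a := fun n hn a ↦ dif_pos hn
  have hlt : ∀ (n : ℕ) (hn : ¬ n₀ ≤ n) (a : ZMod (p ^ n)), μ' n a =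
      ∑ b ∈ Finset.univ.filter (fun b : ZMod (p ^ n₀) ↦
        ZMod.castHom (pow_dvd_pow p (le_of_not_ge hn)) (ZMod (p ^ n)) b = a), μ n₀ b := fun n hn a ↦ dif_neg hn
  have hdist' : ∀ (n : ℕ) (a : ZMod (p ^ n)),
      ∑ b ∈ Finset.univ.filter (fun b : ZMod (p ^ (n + 1)) ↦
        ZMod.castHom (pow_dvd_pow p n.le_succ) (ZMod (p ^ n)) b = a), μ' (n + 1) b = μ' n a := by
    intro n a
    by_cases hn : n₀ ≤ n
    · rw [hge n hn]
      simp_rw [hge (n + 1) (Nat.le_succ_of_le hn)]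
      exact hdist n hn a
    by_cases hn1 : n₀ ≤ n + 1
    · obtain rfl : n₀ = n + 1 := le_antisymm hn1 (by omega)
      rw [hlt n hn]
      simp_rw [hge (n + 1) le_rfl]
    · rw [hlt n hn]
      simp_rw [hlt (n + 1) hn1]
      rw [← Finset.sum_fiberwise_of_maps_to
        (s := Finset.univ.filter (fun b : ZMod (p ^ n₀) ↦
          ZMod.castHom (pow_dvd_pow p (le_of_not_ge hn)) (ZMod (p ^ n)) b = a))
        (t := Finset.univ.filter (fun b : ZMod (p ^ (n + 1)) ↦
          ZMod.castHom (pow_dvd_pow p n.le_succ) (ZMod (p ^ n)) b = a))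
        (g := ZMod.castHom (pow_dvd_pow p (le_of_not_ge hn1)) (ZMod (p ^ (n + 1))))]
      · refine Finset.sum_congr rfl fun y hy ↦ Finset.sum_congr ?_ fun _ _ ↦ rfl
        ext x
        simp only [Finset.mem_filter, Finset.mem_univ, true_and, iff_and_self]
        intro hx
        rw [← (Finset.mem_filter.mp hy).2, ← hx, castHom_castHom_zmod]
      · intro x hx
        simp only [Finset.mem_filter, Finset.mem_univ, true_and] at hx ⊢
        rw [castHom_castHom_zmod]
        exact hx
  have hC' : ∀ (n : ℕ) (a : ZMod (p ^ n)), ‖μ' n a‖ ≤ C := by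
    intro n a
    by_cases hn : n₀ ≤ n
    · rw [hge n hn]; exact hC n a
    · rw [hlt n hn]
      exact IsUltrametricDist.norm_sum_le_of_forall_le_of_nonneg hC0 fun b _ ↦ hC _ _
  have ht := tendsto_riemannSum_of_distribution (distributionRiemannSum_spec μ') hdist' hC' k
  have hev : (fun n ↦ distributionRiemannSum μ' k n) =ᶠ[atTop] distributionRiemannSum μ k := by
    refine eventually_atTop.2 ⟨n₀, fun n hn ↦ ?_⟩
    simp only [distributionRiemannSum, hge (n + cyclotomicExponent p) (hn.trans (Nat.le_add_right _ _))]
  rw [coeff_distributionTransform]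
  exact tendsto_nhds_limUnder ⟨_, ht.congr' hev⟩

/-! ## 6. Pull-back from the previous level: `RS(π^*h)(k, n+1) = p·RS(h)(k, n) + o(1)` -/

omit [Fact p.Prime] in
/-- Summing a function of `s.val` over `ℤ/Mℤ` is summing over `0 ≤ i < M`. [folklore] -/
private theorem sum_univ_zmod_val {M : ℕ} [NeZero M] {R : Type*} [AddCommMonoid R] (G : ℕ → R) :
    ∑ b : ZMod M, G b.val = ∑ i ∈ Finset.range M, G i := by
  obtain ⟨M', rfl⟩ := Nat.exists_eq_succ_of_ne_zero (NeZero.ne M)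
  exact Fin.sum_univ_eq_sum_range G (M' + 1)

omit [Fact p.Prime] in
/-- `∑_{x < a·m} f x = ∑_{j < m} ∑_{x < a} f (a·j + x)`. [folklore] -/
private theorem sum_range_mul_eq {R : Type*} [AddCommMonoid R] (f : ℕ → R) (a m : ℕ) :
    ∑ x ∈ Finset.range (a * m), f x = ∑ j ∈ Finset.range m, ∑ x ∈ Finset.range a, f (a * j + x) := by
  induction m with
  | zero => simp
  | succ m ih => rw [Nat.mul_succ, Finset.sum_range_add, ih, Finset.sum_range_succ]

/-- The pull-back coefficients `c(n, i) = ∑_{j < p} (pⁿ·j choose i)` have `c(n, 0) = p`. [folklore] -/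
private theorem pullbackCoeff_zero (n : ℕ) :
    ∑ j ∈ Finset.range p, (((p ^ n * j).choose 0 : ℕ) : ℚ_[p]) = p := by
  simp

/-- `‖c(n, i+1)‖ ≤ p^{−n}/‖i+1‖`, from `(i+1)·(M choose i+1) = M·(M−1 choose i)`. [folklore] -/
private theorem norm_pullbackCoeff_succ_le (n i : ℕ) :
    ‖∑ j ∈ Finset.range p, (((p ^ n * j).choose (i + 1) : ℕ) : ℚ_[p])‖ ≤
      (p : ℝ) ^ (-n : ℤ) / ‖((i + 1 : ℕ) : ℚ_[p])‖ := by
  have hi : ((i + 1 : ℕ) : ℚ_[p]) ≠ 0 := by exact_mod_cast Nat.succ_ne_zero i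
  have hipos : 0 < ‖((i + 1 : ℕ) : ℚ_[p])‖ := norm_pos_iff.mpr hi
  refine IsUltrametricDist.norm_sum_le_of_forall_le_of_nonneg (by positivity) fun j _ ↦ ?_
  rcases Nat.eq_zero_or_pos j with rfl | hj
  · rw [mul_zero, Nat.choose_zero_succ, Nat.cast_zero, norm_zero]
    positivity
  · obtain ⟨M, hM⟩ : ∃ M, p ^ n * j = M + 1 :=
      Nat.exists_eq_succ_of_ne_zero (Nat.pos_iff_ne_zero.mp (Nat.mul_pos (pow_pos (Fact.out : p.Prime).pos n) hj))
    have hid : (((p ^ n * j).choose (i + 1) : ℕ) : ℚ_[p]) =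
        ((p ^ n * j : ℕ) : ℚ_[p]) * (M.choose i : ℕ) / ((i + 1 : ℕ) : ℚ_[p]) := by
      rw [eq_div_iff hi, hM]
      exact_mod_cast (Nat.add_one_mul_choose_eq M i).symm
    rw [hid, norm_div, norm_mul, div_le_div_iff_of_pos_right hipos]
    have h1 : ‖((M.choose i : ℕ) : ℚ_[p])‖ ≤ 1 := by
      rw [← Int.cast_natCast]; exact Padic.norm_int_le_one _
    have h2 : ‖((p ^ n * j : ℕ) : ℚ_[p])‖ ≤ (p : ℝ) ^ (-n : ℤ) := by
      push_cast
      rw [norm_mul, Padic.norm_p_pow]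
      have h3 : ‖(j : ℚ_[p])‖ ≤ 1 := by rw [← Int.cast_natCast]; exact Padic.norm_int_le_one _
      calc (p : ℝ) ^ (-n : ℤ) * ‖(j : ℚ_[p])‖ ≤ (p : ℝ) ^ (-n : ℤ) * 1 := by gcongr
        _ = _ := mul_one _
    calc ‖((p ^ n * j : ℕ) : ℚ_[p])‖ * ‖((M.choose i : ℕ) : ℚ_[p])‖ ≤ (p : ℝ) ^ (-n : ℤ) * 1 :=
          mul_le_mul h2 h1 (norm_nonneg _) (by positivity)
      _ = _ := mul_one _

/-- `c(n, i+1) → 0`. [folklore] -/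
private theorem tendsto_pullbackCoeff_succ (i : ℕ) :
    Tendsto (fun n ↦ ∑ j ∈ Finset.range p, (((p ^ n * j).choose (i + 1) : ℕ) : ℚ_[p])) atTop (𝓝 0) := by
  refine squeeze_zero_norm (fun n ↦ norm_pullbackCoeff_succ_le n i) ?_
  have h := tendsto_errorScale (p := p) 1 0
  simp only [Nat.factorial_zero, Nat.cast_one, norm_one, div_one, one_mul] at h
  simpa using h.div_const ‖((i + 1 : ℕ) : ℚ_[p])‖

/-- `γ^{pⁿ} = 1` in `ℤ/p^{n+e₀}`. [cite: MazurTateTeitelbaum1986Invent, §I.13 (γ generates 1 + p^{e₀}ℤ_p)] -/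
theorem cyclotomicGenerator_pow_pow_eq_one (n : ℕ) :
    (cyclotomicGenerator p : ZMod (p ^ (n + cyclotomicExponent p))) ^ p ^ n = 1 := by
  rw [← orderOf_cyclotomicGenerator (p := p) n]
  exact pow_orderOf_eq_one _

/-- **The Riemann sums of a pull-back, at finite level.** If `H` is the pull-back of `h` from the previous level
(`H(m+1, a) = h(m, a mod p^m)`), then
`RS(H)(k, n+1) = ∑_{i ≤ k} c(n, i)·RS(h)(k−i, n)` with `c(n, i) = ∑_{j < p} (pⁿj choose i)` (`c(n,0) = p`,
`c(n, i) → 0` for `i ≥ 1`): the `p^{n+1}` sample points `ηγ^s`, `s = s' + pⁿj`, of level `n+1` lie over the sample points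
`ηγ^{s'}` of level `n` (`γ^{pⁿ} = 1` there), and `(s'+pⁿj choose k) = ∑_i (pⁿj choose i)(s' choose k−i)` (Vandermonde).
[cite: MazurTateTeitelbaum1986Invent, §I.13 (pp. 18–19)] -/
theorem distributionRiemannSum_pullback_succ {h H : (n : ℕ) → ZMod (p ^ n) → ℚ_[p]}
    (hH : ∀ (m : ℕ) (a : ZMod (p ^ (m + 1))),
      H (m + 1) a = h m (ZMod.castHom (pow_dvd_pow p m.le_succ) (ZMod (p ^ m)) a))
    (k n : ℕ) :
    distributionRiemannSum H k (n + 1) =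
      ∑ i ∈ Finset.range (k + 1), (∑ j ∈ Finset.range p, (((p ^ n * j).choose i : ℕ) : ℚ_[p])) *
        distributionRiemannSum h (k - i) n := by
  classical
  haveI := neZero_torsionOrder p
  haveI := Fintype.ofFinite (rootsOfUnity (torsionOrder p) ℤ_[p])
  haveI : NeZero (p ^ n) := ⟨pow_ne_zero _ (Fact.out : p.Prime).ne_zero⟩
  haveI : NeZero (p ^ (n + 1)) := ⟨pow_ne_zero _ (Fact.out : p.Prime).ne_zero⟩
  -- per Teichmüller class: the `s`-sum at level `n + 1` against a weight `w` on `ℤ/p^{n+e₀}`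
  have key : ∀ w : ZMod (p ^ (n + cyclotomicExponent p)) → ℚ_[p],
      ∑ s : ZMod (p ^ (n + 1)),
          w ((cyclotomicGenerator p : ZMod (p ^ (n + cyclotomicExponent p))) ^ s.val) * ((s.val.choose k : ℕ) : ℚ_[p]) =
        ∑ i ∈ Finset.range (k + 1), (∑ j ∈ Finset.range p, (((p ^ n * j).choose i : ℕ) : ℚ_[p])) *
          ∑ s : ZMod (p ^ n),
            w ((cyclotomicGenerator p : ZMod (p ^ (n + cyclotomicExponent p))) ^ s.val) *
              ((s.val.choose (k - i) : ℕ) : ℚ_[p]) := by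
    intro w
    rw [sum_univ_zmod_val (fun x ↦ w ((cyclotomicGenerator p : ZMod (p ^ (n + cyclotomicExponent p))) ^ x) *
      ((x.choose k : ℕ) : ℚ_[p])), pow_succ, sum_range_mul_eq]
    have hin : ∑ i ∈ Finset.range (k + 1),
        (∑ j ∈ Finset.range p, (((p ^ n * j).choose i : ℕ) : ℚ_[p])) *
          ∑ s : ZMod (p ^ n), w ((cyclotomicGenerator p : ZMod (p ^ (n + cyclotomicExponent p))) ^ s.val) *
            ((s.val.choose (k - i) : ℕ) : ℚ_[p]) =
        ∑ i ∈ Finset.range (k + 1), ∑ j ∈ Finset.range p, ∑ x ∈ Finset.range (p ^ n),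
          (((p ^ n * j).choose i : ℕ) : ℚ_[p]) *
            (w ((cyclotomicGenerator p : ZMod (p ^ (n + cyclotomicExponent p))) ^ x) *
              ((x.choose (k - i) : ℕ) : ℚ_[p])) := by
      refine Finset.sum_congr rfl fun i _ ↦ ?_
      rw [sum_univ_zmod_val (fun x ↦ w ((cyclotomicGenerator p : ZMod (p ^ (n + cyclotomicExponent p))) ^ x) *
        ((x.choose (k - i) : ℕ) : ℚ_[p])), Finset.sum_mul]
      refine Finset.sum_congr rfl fun j _ ↦ ?_
      rw [Finset.mul_sum]
    rw [hin]
    conv_rhs => rw [Finset.sum_comm]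
    refine Finset.sum_congr rfl fun j _ ↦ ?_
    rw [Finset.sum_comm]
    refine Finset.sum_congr rfl fun x _ ↦ ?_
    -- `γ^{pⁿ j + x} = γ^x` and Vandermonde
    rw [pow_add, pow_mul, cyclotomicGenerator_pow_pow_eq_one, one_pow, one_mul, Nat.add_choose_eq,
      Finset.Nat.sum_antidiagonal_eq_sum_range_succ_mk, Nat.cast_sum, Finset.mul_sum]
    refine Finset.sum_congr rfl fun i _ ↦ ?_
    push_cast
    ring
  -- level bookkeeping `n + 1 + e₀ = (n + e₀) + 1`, then `H = π^*h` on the sample points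
  have hlev : n + 1 + cyclotomicExponent p = n + cyclotomicExponent p + 1 := by omega
  rw [distributionRiemannSum, hlev]
  simp_rw [hH, map_mul, map_pow, map_natCast, ZMod.castHom_apply,
    PadicInt.cast_toZModPow _ _ (Nat.le_succ (n + cyclotomicExponent p))]
  rw [finsum_eq_sum_of_fintype,
    Finset.sum_congr rfl fun (η : rootsOfUnity (torsionOrder p) ℤ_[p]) _ ↦
      key (fun x ↦ h (n + cyclotomicExponent p)
        (PadicInt.toZModPow (n + cyclotomicExponent p) ((η : ℤ_[p]ˣ) : ℤ_[p]) * x)),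
    Finset.sum_comm]
  simp only [distributionRiemannSum, finsum_eq_sum_of_fintype, Finset.mul_sum]

/-- **PULL-BACK: `RS(π^*h)(k, ·) → p · lim RS(h)(k, ·)`**, i.e. `L(π^*h) = p·L(h)` coefficientwise (`= 2·L(h)` at
`p = 2`), for any set function `h` whose Riemann sums `RS(h)(i, ·)` converge for `i ≤ k` and its pull-back `H = π^*h`
from the previous level (`H(m+1, a) = h(m, a mod p^m)`; no hypothesis at level `0`).
[cite: MazurTateTeitelbaum1986Invent, §I.13 (pp. 18–19)] -/
theorem tendsto_distributionRiemannSum_pullback {h H : (n : ℕ) → ZMod (p ^ n) → ℚ_[p]}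
    (hH : ∀ (m : ℕ) (a : ZMod (p ^ (m + 1))),
      H (m + 1) a = h m (ZMod.castHom (pow_dvd_pow p m.le_succ) (ZMod (p ^ m)) a))
    (k : ℕ) {R : ℕ → ℚ_[p]} (hconv : ∀ i ≤ k, Tendsto (distributionRiemannSum h i) atTop (𝓝 (R i))) :
    Tendsto (distributionRiemannSum H k) atTop (𝓝 ((p : ℚ_[p]) * R k)) := by
  rw [← tendsto_add_atTop_iff_nat 1]
  simp_rw [distributionRiemannSum_pullback_succ hH, Finset.sum_range_succ' _ k, Nat.choose_zero_right, Nat.cast_one,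
    Finset.sum_const, Finset.card_range, nsmul_eq_mul, mul_one, Nat.sub_zero]
  have hsucc : ∀ i ∈ Finset.range k, Tendsto (fun n ↦
      (∑ j ∈ Finset.range p, (((p ^ n * j).choose (i + 1) : ℕ) : ℚ_[p])) * distributionRiemannSum h (k - (i + 1)) n)
      atTop (𝓝 0) := fun i hi ↦ by
    have := (tendsto_pullbackCoeff_succ (p := p) i).mul (hconv (k - (i + 1)) (by omega))
    simpa using this
  have := (tendsto_finsetSum _ hsucc).add ((hconv k le_rfl).const_mul (p : ℚ_[p]))
  simpa using this

/-! ## 7. Level constants: `g(n)·∑_{s<pⁿ} (s choose k) → c·(−1)^k/(k+1)` when `pⁿ·g(n) → c` -/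

omit [Fact p.Prime] in
/-- `∑_{s < N} (s choose k) = (N choose k+1)` (hockey stick). [folklore] -/
private theorem sum_range_choose_eq (N k : ℕ) : ∑ s ∈ Finset.range N, s.choose k = N.choose (k + 1) := by
  induction N with
  | zero => simp
  | succ N ih => rw [Finset.sum_range_succ, ih, Nat.choose_succ_succ' N k, add_comm]

/-- `(−1 choose k) = (−1)^k` in `ℤ_p`. [folklore] -/
private theorem ring_choose_neg_one (k : ℕ) : Ring.choose (-1 : ℤ_[p]) k = (-1) ^ k := by
  rw [Ring.choose_neg', Ring.multichoose_one, Units.smul_def, Int.coe_negOnePow_natCast, zsmul_eq_mul, mul_one]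
  push_cast
  rfl

/-- `‖(pⁿ − 1 choose k) − (−1)^k‖ ≤ p^{−n}/‖k!‖` (`p`-adic continuity of `x ↦ (x choose k)` at `x = −1`). [folklore] -/
private theorem norm_choose_pow_sub_one_sub_le (n k : ℕ) :
    ‖(((p ^ n - 1).choose k : ℕ) : ℚ_[p]) - (-1) ^ k‖ ≤ (p : ℝ) ^ (-n : ℤ) / ‖((k.factorial : ℕ) : ℚ_[p])‖ := by
  have h := norm_choose_sub_choose_le_of_sub_mem_span (p := p) (x := ((p ^ n - 1 : ℕ) : ℤ_[p])) (y := -1) (n := n) k ?_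
  · rwa [Ring.choose_natCast, ring_choose_neg_one, map_natCast, map_pow, map_neg, map_one] at h
  · rw [Ideal.mem_span_singleton, sub_neg_eq_add]
    have h1 : 1 ≤ p ^ n := Nat.one_le_pow _ _ (Fact.out : p.Prime).pos
    refine ⟨1, ?_⟩
    rw [mul_one]
    exact_mod_cast Nat.sub_add_cancel h1

/-- **Level constants.** If `pⁿ·g(n) → c` in `ℚ_p`, then `g(n)·∑_{s < pⁿ} (s choose k) → c·(−1)^k/(k+1)`: indeed
`∑_{s<pⁿ} (s choose k) = (pⁿ choose k+1) = pⁿ·(pⁿ−1 choose k)/(k+1)` and `(pⁿ−1 choose k) → (−1 choose k) = (−1)^k`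
`p`-adically. (As a power series in `k`: `c·∑_k (−1)^k T^k/(k+1) = c·log(1+T)/T` — the "transform" of the level
constants `g(n)·𝟙`, which do not form a distribution.) [cite: MazurTateTeitelbaum1986Invent, §I.13 (pp. 18–19)] -/
theorem tendsto_mul_sum_range_choose {g : ℕ → ℚ_[p]} {c : ℚ_[p]}
    (hg : Tendsto (fun n ↦ (p : ℚ_[p]) ^ n * g n) atTop (𝓝 c)) (k : ℕ) :
    Tendsto (fun n ↦ g n * ∑ s ∈ Finset.range (p ^ n), ((s.choose k : ℕ) : ℚ_[p])) atTop
      (𝓝 (c * (-1) ^ k / ((k + 1 : ℕ) : ℚ_[p]))) := by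
  have hk : ((k + 1 : ℕ) : ℚ_[p]) ≠ 0 := by exact_mod_cast Nat.succ_ne_zero k
  -- `g(n)·∑ = (pⁿ g(n))·(pⁿ−1 choose k)/(k+1)`
  have hid : ∀ n, g n * ∑ s ∈ Finset.range (p ^ n), ((s.choose k : ℕ) : ℚ_[p]) =
      (p : ℚ_[p]) ^ n * g n * (((p ^ n - 1).choose k : ℕ) : ℚ_[p]) / ((k + 1 : ℕ) : ℚ_[p]) := by
    intro n
    have h1 : 1 ≤ p ^ n := Nat.one_le_pow _ _ (Fact.out : p.Prime).pos
    obtain ⟨M, hM⟩ : ∃ M, p ^ n = M + 1 := ⟨p ^ n - 1, (Nat.sub_add_cancel h1).symm⟩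
    have hnat : ((p ^ n).choose (k + 1) : ℚ_[p]) * ((k + 1 : ℕ) : ℚ_[p]) =
        (p ^ n : ℕ) * (((p ^ n - 1).choose k : ℕ) : ℚ_[p]) := by
      rw [hM, Nat.add_sub_cancel]
      exact_mod_cast (Nat.add_one_mul_choose_eq M k).symm
    rw [← Nat.cast_sum, sum_range_choose_eq, eq_div_iff hk, mul_assoc, hnat]
    push_cast
    ring
  simp_rw [hid]
  have hchoose : Tendsto (fun n ↦ (((p ^ n - 1).choose k : ℕ) : ℚ_[p])) atTop (𝓝 ((-1) ^ k)) := by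
    have h0 : Tendsto (fun n ↦ (((p ^ n - 1).choose k : ℕ) : ℚ_[p]) - (-1) ^ k) atTop (𝓝 0) := by
      refine squeeze_zero_norm (norm_choose_pow_sub_one_sub_le (p := p) · k) ?_
      have h := tendsto_errorScale (p := p) 1 k
      simpa using h
    have := h0.add_const ((-1 : ℚ_[p]) ^ k)
    simpa using this
  exact ((hg.mul hchoose).div_const _)

/-- The same over the sample classes: `g(n)·∑_{s : ℤ/pⁿ} (s.val choose k) → c·(−1)^k/(k+1)` — the level-constant terms
`E(n+e₀, 1)·∑_s (s choose k)` of a Riemann sum. [cite: MazurTateTeitelbaum1986Invent, §I.13 (pp. 18–19)] -/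
theorem tendsto_mul_sum_zmod_choose {g : ℕ → ℚ_[p]} {c : ℚ_[p]}
    (hg : Tendsto (fun n ↦ (p : ℚ_[p]) ^ n * g n) atTop (𝓝 c)) (k : ℕ) :
    Tendsto (fun n ↦ g n * ∑ s : ZMod (p ^ n), ((s.val.choose k : ℕ) : ℚ_[p])) atTop
      (𝓝 (c * (-1) ^ k / ((k + 1 : ℕ) : ℚ_[p]))) := by
  have h := tendsto_mul_sum_range_choose hg k
  refine h.congr fun n ↦ ?_
  haveI : NeZero (p ^ n) := ⟨pow_ne_zero _ (Fact.out : p.Prime).ne_zero⟩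
  rw [sum_univ_zmod_val (fun x ↦ ((x.choose k : ℕ) : ℚ_[p]))]

end Literature.NumberTheory.EllipticCurves

end
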